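import Literature.AlgebraicGeometry.HodgeTheory.PicardLefschetzExchangedPairOfMeridians
import Literature.AlgebraicGeometry.HodgeTheory.PicardLefschetzDataIsometryConj
import Literature.AlgebraicGeometry.HodgeTheory.PicardLefschetzDataLeash
import HarnessLib

/-!
# The abstract core of programme «PL2-MERIDIANS»: two-node Picard–Lefschetz data from ONE one-node meridian,
# a leash, a symmetry conjugating it, and the decomposition of the pencil circle

Family `hodge`, layer `Literature/AlgebraicGeometry/HodgeTheory`. Theorems only. Written by the prover seat
`hodge-nonav-20241-p1` (g18, cell `hodge-nonav`) for the registry binder hPL₂exch = `picardLefschetz_exchangedPair`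
(crux K1-B, stmt-HodgeConjecture-19716, route `HodgeConjecture/SignSymmetricPowers`).

THE CORE (all geometry abstracted into hypotheses that the bricks (P1)(P2)(P4) supply). At a base point `s′` with
a loop `γ` (the pencil circle around the two-nodal member), suppose given:
* one-node Picard–Lefschetz data `(![δ₀]; c₀)` for a loop `μ₀` at some point `s₀` (hPL₁ at a one-nodal member
  of branch 0) and a leash `α : s′ ⤳ s₀`; put `ℓ₀ := α·μ₀·α⁻¹`;
* a loop `ℓ₁` at `s′` (the image of `ℓ₀` under the exchanging symmetry) whose rational transports are, degree by
  degree, the conjugates of those of `ℓ₀` — in the middle degree by an ISOMETRY `R` of `B = tr ∘ ∪`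
  (`x ↦ R (T (R⁻¹ x))`), and trivial where those of `ℓ₀` are trivial;
* the decomposition `[γ] = [ℓ₀]·[ℓ₁]` with `[ℓ₀]·[ℓ₁] = [ℓ₁]·[ℓ₀]` (local abelianness of `π₁` off two transversal
  branches), and the even-`n` rider `T_γ ≠ 1`.
Then `γ` carries Picard–Lefschetz data for TWO cycles `(![δ, Rδ]; c)` — assembled from
`IsPicardLefschetzData.exists_of_leash`, `.of_isometry_conj`, `.two_of_loopClassUniv_eq_trans`; and also in the
swapped order `(![Rδ, δ]; c)` (`IsPicardLefschetzData.two_swap`), so that either orientation of the conjugation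
matches the exchange clause `σ′^* δ 0 = δ 1` of `picardLefschetz_exchangedPair`.

Honest scope: conditional assembly; nothing here proves hPL₂exch or HC.

## References

* [VoisinHodgeII2003] C. Voisin, Hodge Theory and Complex Algebraic Geometry II, CUP 2003, §3.2.1 Thm. 3.16,
  Cor. 3.17, Rem. 3.21; §2.3.1–2.3.2, §3.1.2.
* [ArnoldGuseinzadeVarchenko2012] AGZV II, Part I §1.3, §2.1.
-/

noncomputable section

open CategoryTheory AlgebraicGeometry MvPolynomial
open Literature.AlgebraicTopology.SingularHomology
open Literature.AlgebraicGeometry.Motives Literature.AlgebraicGeometry.Motives.UniversalHypersurface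
open Literature.AlgebraicGeometry.HodgeTheory.BettiUniverse

namespace Literature.AlgebraicGeometry.HodgeTheory

variable {n d : ℕ} {hn : 1 ≤ n} {hd : 1 ≤ d} {hU : IsCohomologicallyLocallyTrivialOn (family ℂ n d) Set.univ}

/-- **Swapping the two cycles** of two-node Picard–Lefschetz data. [cite: VoisinHodgeII2003, §3.2.1 Thm. 3.16] -/
theorem IsPicardLefschetzData.two_swap {s : ComplexPoints (base ℂ n d)} {γ : Path s s} {c : ℚ}
    {δ₀ δ₁ : bettiCohomology (fiberOver (family ℂ n d) s) n} (h : IsPicardLefschetzData n d 2 hn hd hU γ ![δ₀, δ₁] c) :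
    IsPicardLefschetzData n d 2 hn hd hU γ ![δ₁, δ₀] c := by
  obtain ⟨hc, horth, ⟨T, hT, hTx⟩, hoff, heven, hodd⟩ := h
  refine ⟨hc, fun i i' hii' => ?_, ⟨T, hT, fun x => ?_⟩, hoff, fun hev i => ?_, fun hod i => ?_⟩
  · fin_cases i <;> fin_cases i'
    · exact absurd rfl hii'
    · exact horth 1 0 (by decide)
    · exact horth 0 1 (by decide)
    · exact absurd rfl hii'
  · rw [hTx x, Fin.sum_univ_two, Fin.sum_univ_two]
    simp only [Matrix.cons_val_zero, Matrix.cons_val_one]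
    rw [add_comm (_ • δ₀)]
  · fin_cases i
    · exact heven hev 1
    · exact heven hev 0
  · fin_cases i
    · exact hodd hod 1
    · exact hodd hod 0

/-- **The core of PL2-MERIDIANS: two-node Picard–Lefschetz data from one one-node meridian, a leash, an
isometric conjugation and the commuting decomposition of the pencil circle** (module docstring).
[cite: VoisinHodgeII2003, §3.2.1 Thm. 3.16, Cor. 3.17, Rem. 3.21 and §3.1.2]
[cite: ArnoldGuseinzadeVarchenko2012, Part I §1.3 and §2.1 Thm. 2.1] -/
theorem exists_isPicardLefschetzData_two_of_meridian {s' s₀ : ComplexPoints (base ℂ n d)} {γ ℓ₁ : Path s' s'}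
    {μ₀ : Path s₀ s₀} (α : Path s' s₀) {δ₀ : bettiCohomology (fiberOver (family ℂ n d) s₀) n} {c₀ : ℚ}
    (hμ : IsPicardLefschetzData n d 1 hn hd hU μ₀ ![δ₀] c₀)
    (R : bettiCohomology (fiberOver (family ℂ n d) s') n ≃ₗ[ℚ] bettiCohomology (fiberOver (family ℂ n d) s') n)
    (hR : ∀ x y, tr ((isSmoothProjectiveFamily_family ℂ hn hd).isSmoothProjective s') (n + n)
        (cup (fiberOver (family ℂ n d) s') n n (R x) (R y)) =
      tr ((isSmoothProjectiveFamily_family ℂ hn hd).isSmoothProjective s') (n + n)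
        (cup (fiberOver (family ℂ n d) s') n n x y))
    (hℓ₁ : ∀ T : bettiCohomology (fiberOver (family ℂ n d) s') n ≃ₗ[ℚ] bettiCohomology (fiberOver (family ℂ n d) s') n,
      IsRatTransport (family ℂ n d) n hU (loopClassUniv n d ((α.trans μ₀).trans α.symm)) T →
        IsRatTransport (family ℂ n d) n hU (loopClassUniv n d ℓ₁) (R.symm.trans (T.trans R)))
    (hℓ₁off : ∀ k', k' ≠ n →
      IsRatTransport (family ℂ n d) k' hU (loopClassUniv n d ((α.trans μ₀).trans α.symm)) (LinearEquiv.refl ℚ _) →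
        IsRatTransport (family ℂ n d) k' hU (loopClassUniv n d ℓ₁) (LinearEquiv.refl ℚ _))
    (hγ : loopClassUniv n d γ = (loopClassUniv n d ((α.trans μ₀).trans α.symm)).trans (loopClassUniv n d ℓ₁))
    (hcomm : (loopClassUniv n d ((α.trans μ₀).trans α.symm)).trans (loopClassUniv n d ℓ₁) =
      (loopClassUniv n d ℓ₁).trans (loopClassUniv n d ((α.trans μ₀).trans α.symm)))
    (hne : Even n → ∀ T : bettiCohomology (fiberOver (family ℂ n d) s') n ≃ₗ[ℚ] bettiCohomology (fiberOver (family ℂ n d) s') n,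
      IsRatTransport (family ℂ n d) n hU (loopClassUniv n d γ) T → T ≠ LinearEquiv.refl ℚ _) :
    ∃ (δ : bettiCohomology (fiberOver (family ℂ n d) s') n) (c : ℚ),
      IsPicardLefschetzData n d 2 hn hd hU γ ![δ, R δ] c ∧ IsPicardLefschetzData n d 2 hn hd hU γ ![R δ, δ] c := by
  -- one-node data for `ℓ₀ = α·μ₀·α⁻¹` at `s'`
  obtain ⟨δ', c, h₀⟩ := hμ.exists_of_leash α
  set ℓ₀ := (α.trans μ₀).trans α.symm with hℓ₀
  -- its transport `T₀`, and the conjugate transport `T₁` of `ℓ₁`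
  obtain ⟨T₀, hT₀, -⟩ := h₀.2.2.1
  have hT₁ := hℓ₁ T₀ hT₀
  set T₁ := R.symm.trans (T₀.trans R) with hT₁def
  -- one-node data `(R δ')` for `ℓ₁`
  have hδ' : (fun i : Fin 1 => R (![δ' 0] i)) = ![R (δ' 0)] := by
    funext i; fin_cases i; rfl
  have h₀' : IsPicardLefschetzData n d 1 hn hd hU ℓ₀ ![δ' 0] c := by
    have : (![δ' 0] : Fin 1 → _) = δ' := by funext i; fin_cases i; rfl
    rw [this]; exact h₀
  have h₁ : IsPicardLefschetzData n d 1 hn hd hU ℓ₁ ![R (δ' 0)] c := by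
    have h := IsPicardLefschetzData.of_isometry_conj R h₀' hT₀ hR hT₁ (fun k' hk' => hℓ₁off k' hk' (h₀.2.2.2.1 k' hk'))
    rwa [hδ'] at h
  -- the two transports commute (the classes commute and transports are unique)
  have hcommT : T₀.trans T₁ = T₁.trans T₀ := by
    have h1 : IsRatTransport (family ℂ n d) n hU ((loopClassUniv n d ℓ₀).trans (loopClassUniv n d ℓ₁)) (T₀.trans T₁) :=
      hT₀.trans (family ℂ n d) n hU hT₁
    have h2 : IsRatTransport (family ℂ n d) n hU ((loopClassUniv n d ℓ₁).trans (loopClassUniv n d ℓ₀)) (T₁.trans T₀) :=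
      hT₁.trans (family ℂ n d) n hU hT₀
    rw [← hcomm] at h2
    exact isRatTransport_unique_family h1 h2
  -- the even rider for `T₀ ≫ T₁`, the transport of `γ`
  have hne' : Even n → T₀.trans T₁ ≠ LinearEquiv.refl ℚ _ := fun hev => by
    have hT : IsRatTransport (family ℂ n d) n hU (loopClassUniv n d γ) (T₀.trans T₁) := by
      rw [hγ]; exact hT₀.trans (family ℂ n d) n hU hT₁
    exact hne hev _ hT
  have h2 := IsPicardLefschetzData.two_of_loopClassUniv_eq_trans h₀' h₁ hT₀ hT₁ hγ hcommT hne'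
  exact ⟨δ' 0, c, h2, h2.two_swap⟩

end Literature.AlgebraicGeometry.HodgeTheory

end
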